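/-
Copyright (c) 2026 the pub-hodgecm-mathlib formalisation cell (harness21).  Prover seat hodgecm-mathlib-F0P3a-p01 (g36), FLOOR 0, SUPPORTS-ONLY on h413; dealer LH4-plan (g13)
WORD #74 (1): owner of (T-box | lev) (b)+(c).  FILE 3 «THE IDENTITY».  2026-09-04.
-/
import Summits.HodgeConjecture.HodgeConjecture.Theorems.F0P3cDyRamLevLabelledBoxSumDefs      -- ★ p860066 ∕ p860094: the Props
import Summits.HodgeConjecture.HodgeConjecture.Theorems.F0P3cDyRamLevBoxSumPlanes            -- ★ p860250 FILE 1: `kappa_plane_sum_lev`, `kappa_diag_sum_lev`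
import Summits.HodgeConjecture.HodgeConjecture.Theorems.F0P3cDyRamLevBoxSumTilingDispatch    -- FILE 2f: `kappa_arith_lev`
import Summits.HodgeConjecture.HodgeConjecture.Theorems.F0P3cDyRamStableCountBoxReindex      -- ★ `sum_box_eq_triple_sum`, `triple_sum_eq_diag_add_planes`, `vec3_eq_iff`
import HarnessLib

/-!
# Crux `H413`, LH4 «(D-RAM) FOUR-FRAME» road, STAGE 1b — brick (T-box | lev) FILE 3∕3 «THE IDENTITY»: `LevLabelledBoxSumWide ℓ₁ ℓ₂` (and `LevLabelledBoxSum`) HOLD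

Cell `hodgecm-mathlib` (D-0151), crux item H413 = `stmt-HodgeConjecture-24833`, route of record `HCCMUnconditional`.  THEOREMS ONLY (no `def`, no instance, no notation,
no `sorry`, default heartbeats); lane `--supports stmt-HodgeConjecture-24833 --as helper` (count-neutral).  This file DISCHARGES the named Props ★ p860066 ∕ p860094
(`LevLabelledBoxSum`, `LevLabelledBoxSumWide`) — the two-token labelled κ-box-sum consumed as `hbox` by the (T-asm | lev) assembler of LH4-p12 (g7) ∕ LH4-p09 (g8)
(dealer WORD #74 ∕ #83), whence the four `hTrunk` binders of ★ p859769 §3 ∕ ★ p859848 §3 and the four (L-lev) law stubs.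
MECHANISM = ★ p856906 `sum_box_kappa_eq_typeZero`'s proof shape verbatim: parity-killed cells (`hzero`), the box re-indexed into the diagonal and the three apex planes
(★ `sum_box_eq_triple_sum`, ★ `triple_sum_eq_diag_add_planes`), each evaluated by FILE 1 (`kappa_diag_sum_lev`, `kappa_plane_sum_lev` with read legs `n₂, n₁, n₂`), the blocks
multiplied by `q − 1` (★ `foot_mul_eval`, ★ `window_mul_eval'`), and the exponent bookkeeping `kappa_arith_lev` (FILE 2).  The one new wrinkle is the bracket: the Prop's guards
`2d ≤ s + (X+1)` ∕ `2d ≤ X + 1` (`X = ℓ₁ + 2ρ − n_g`) are the unit's `2d ≤ s + 2c` ∕ `d ≤ c` at `c = ⌈X∕2⌉` up to parity (`s` even): `bracket_own_iff`, `bracket_cross_iff`.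
* `bracket_own_iff`, `bracket_cross_iff`; **`levLabelledBoxSumWide_holds`** — HEAD; `levLabelledBoxSum_holds` — the interior Prop (★ `levLabelledBoxSum_of_wide`).

HONEST LABEL: an arithmetic Prop discharged; it pays no tier-0 row by itself (the assembler and the ED. 5∕6 pay lines do); HC_CM is proved only modulo the 7 printed citations
(2 remaining named inputs: hLiu418 = `stmt-HodgeConjecture-24832`, h413 = `stmt-HodgeConjecture-24833`) until rung 0 closes.

## References
* [Kottwitz1986BaseChangeUnits] R. E. Kottwitz, *Base change for unit elements of Hecke algebras*, Compositio Math. 60 (1986), §1 pp. 240–241.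
* [Rogawski1990] J. D. Rogawski, *Automorphic Representations of Unitary Groups in Three Variables*, Ann. of Math. Stud. 123 (1990), §4.9 Prop. 4.9.1 (a) p. 55; §4.10 p. 58.
-/

set_option autoImplicit false

namespace Summit.HodgeConjecture.HodgeConjecture.Cruxes.H413.F0P3cDyRamLevLabelledBoxSum

open Finset
open Summit.HodgeConjecture.HodgeConjecture.Cruxes.H413.F0P3cDyRamLevLabelledBoxSumDefs
open Summit.HodgeConjecture.HodgeConjecture.Cruxes.H413.F0P3cDyRamStableCountBoxReindex (vec3_eq_iff sum_box_eq_triple_sum triple_sum_eq_diag_add_planes)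
open Summit.HodgeConjecture.HodgeConjecture.Cruxes.H413.F0P3cDyRamKappaCountBoxSumPlanes (foot_mul_eval window_mul_eval window_mul_eval' vec_single_ite vec_bracket_ite)
open Summit.HodgeConjecture.HodgeConjecture.Cruxes.H413.F0P3cDyRamLevBoxSumPlanes (kappa_plane_sum_lev kappa_diag_sum_lev)
open Summit.HodgeConjecture.HodgeConjecture.Cruxes.H413.F0P3cDyRamLevBoxSumTilingDispatch (kappa_arith_lev)

/-- The own-slot bracket parity bridge: for even `s`, `2d ≤ s + (X + 1) ↔ 2d ≤ s + 2·⌈X∕2⌉` (`⌈X∕2⌉ = (X+1)∕2`). [folklore] -/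
theorem bracket_own_iff {d s X : ℕ} (hs : 2 ∣ s) : 2 * d ≤ s + (X + 1) ↔ 2 * d ≤ s + 2 * ((X + 1) / 2) := by
  obtain ⟨s', rfl⟩ := hs
  omega

/-- The cross-slot bracket parity bridge: `2d ≤ X + 1 ↔ d ≤ (X+1)∕2`. [folklore] -/
theorem bracket_cross_iff (d X : ℕ) : 2 * d ≤ X + 1 ↔ d ≤ (X + 1) / 2 := by
  omega

/-- **`LevLabelledBoxSumWide ℓ₁ ℓ₂` HOLDS** (brick (T-box | lev), the proof of the named Prop ★ p860094): the two-token labelled κ-box-sum of the level trunks equals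
`SIGN·(q^{k−X} − q^{k−max(X, B+y)})` on the wide fence `ℓ₂ ≤ nᵢ + ℓ₁`. [folklore] -/
theorem levLabelledBoxSumWide_holds (ℓ₁ ℓ₂ : ℕ) : LevLabelledBoxSumWide ℓ₁ ℓ₂ := by
  intro q d n₁ n₂ n₃ Bx k hd hiso hfence hℓ₁ hℓ₂ hcorner h1 h2 h3 hBx hk i ω εH εG hω0 hω1 hω2 v hcore hT1 hT2 hT3 hG1 hG2 hG3 hH hzero
  obtain ⟨hf1, hf2, hf3⟩ := hfence
  have hd1 : 1 ≤ d := by omega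
  have hdn1 : d + ℓ₁ ≤ n₁ := by omega
  have hdn2 : d + ℓ₁ ≤ n₂ := by omega
  have hdn3 : d + ℓ₁ ≤ n₃ := by omega
  -- (0) the odd-parity cells are off the shape list
  have hz_diag : ∀ r, 1 ≤ r → ¬ 2 ∣ r → v ![r, r, r] = 0 := fun r hr hr2 => hzero _ (by
    rintro (h | ⟨s', hs', -, h | h | h⟩ | ⟨ρ, s', hρ, hs', -, h | h | h⟩ | ⟨ρ, hρ, h⟩) <;> rw [vec3_eq_iff] at h <;> omega)
  have hz_p1 : ∀ r s, 1 ≤ r → ¬ 2 ∣ r → 1 ≤ s → v ![r, r + s, r + s] = 0 := fun r s hr hr2 hs => hzero _ (by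
    rintro (h | ⟨s', hs', -, h | h | h⟩ | ⟨ρ, s', hρ, hs', -, h | h | h⟩ | ⟨ρ, hρ, h⟩) <;> rw [vec3_eq_iff] at h <;> omega)
  have hz_p2 : ∀ r s, 1 ≤ r → ¬ 2 ∣ r → 1 ≤ s → v ![r + s, r, r + s] = 0 := fun r s hr hr2 hs => hzero _ (by
    rintro (h | ⟨s', hs', -, h | h | h⟩ | ⟨ρ, s', hρ, hs', -, h | h | h⟩ | ⟨ρ, hρ, h⟩) <;> rw [vec3_eq_iff] at h <;> omega)
  have hz_p3 : ∀ r s, 1 ≤ r → ¬ 2 ∣ r → 1 ≤ s → v ![r + s, r + s, r] = 0 := fun r s hr hr2 hs => hzero _ (by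
    rintro (h | ⟨s', hs', -, h | h | h⟩ | ⟨ρ, s', hρ, hs', -, h | h | h⟩ | ⟨ρ, hρ, h⟩) <;> rw [vec3_eq_iff] at h <;> omega)
  have hreg : ∀ x y z : ℕ, v ![x, y, z] ≠ 0 → (x = y ∧ y = z) ∨ (y = z ∧ x < y) ∨ (x = z ∧ y < x) ∨ (x = y ∧ z < x) := by
    intro x y z hne
    by_contra hc
    refine hne (hzero _ ?_)
    rintro (h | ⟨s', hs', hs2, h | h | h⟩ | ⟨ρ, s', hρ, hs', hs2, h | h | h⟩ | ⟨ρ, hρ, h⟩) <;> rw [vec3_eq_iff] at h <;> omega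
  -- (1) the planes' glued rows in the generic shape (slot bookkeeping + bracket parity)
  have hG1' : ∀ ρ s, 1 ≤ ρ → 1 ≤ s → (fun r t => v ![r, t, t]) (2 * ρ) (2 * ρ + s) =
      (if (i = 0) ∧ 2 ∣ s ∧ 2 * ρ ≤ min n₂ n₃ ∧ 2 * ρ + s ≤ n₁ ∧ 2 * ρ + ℓ₁ ≤ n₂ ∧ 2 * ρ + s + ℓ₁ ≤ n₁ ∧ 2 * ρ + ℓ₂ ≤ 2 * n₂ then
          ω * (q : ℚ) ^ (2 * ρ + s / 2 - 1) * ((if 2 * d ≤ s then (q : ℚ) - 1 else 0) - (if s + 2 = 2 * d then 1 else 0)) else 0) +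
      (if 2 ∣ s ∧ n₂ = n₃ ∧ n₁ = n₂ + s ∧ n₂ < 2 * ρ + ℓ₁ ∧ ℓ₁ + ρ ≤ n₂ ∧ ℓ₁ + 2 * ρ - n₂ ≤ n₂ - d + 1 ∧ 2 * ρ + ℓ₂ ≤ 2 * n₂ then
          (if (fun s c => (i = 0 → 2 * d ≤ s + 2 * c) ∧ (i ≠ 0 → d ≤ c)) s ((ℓ₁ + 2 * ρ - n₂ + 1) / 2) then εG 0 i else 0) *
            (q : ℚ) ^ (2 * ρ + s / 2 - (ℓ₁ + 2 * ρ - n₂ + 1) / 2) else 0) := by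
    intro ρ s hρ hs
    simp only []
    rw [hG1 ρ s hρ hs, (vec_single_ite _ _ i).1, (vec_bracket_ite _ _ (εG 0) i).1]
    congr 1
    by_cases hc : 2 ∣ s ∧ n₂ = n₃ ∧ n₁ = n₂ + s ∧ n₂ < 2 * ρ + ℓ₁ ∧ ℓ₁ + ρ ≤ n₂ ∧ ℓ₁ + 2 * ρ - n₂ ≤ n₂ - d + 1 ∧ 2 * ρ + ℓ₂ ≤ 2 * n₂
    · rw [if_pos hc, if_pos hc]
      congr 1
      exact if_congr (and_congr (imp_congr Iff.rfl (bracket_own_iff hc.1)) (imp_congr Iff.rfl (bracket_cross_iff d _))) rfl rfl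
    · rw [if_neg hc, if_neg hc]
  have hG2' : ∀ ρ s, 1 ≤ ρ → 1 ≤ s → (fun r t => v ![t, r, t]) (2 * ρ) (2 * ρ + s) =
      (if (i = 1) ∧ 2 ∣ s ∧ 2 * ρ ≤ min n₁ n₃ ∧ 2 * ρ + s ≤ n₂ ∧ 2 * ρ + ℓ₁ ≤ n₁ ∧ 2 * ρ + s + ℓ₁ ≤ n₂ ∧ 2 * ρ + ℓ₂ ≤ 2 * n₁ then
          ω * (q : ℚ) ^ (2 * ρ + s / 2 - 1) * ((if 2 * d ≤ s then (q : ℚ) - 1 else 0) - (if s + 2 = 2 * d then 1 else 0)) else 0) +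
      (if 2 ∣ s ∧ n₁ = n₃ ∧ n₂ = n₁ + s ∧ n₁ < 2 * ρ + ℓ₁ ∧ ℓ₁ + ρ ≤ n₁ ∧ ℓ₁ + 2 * ρ - n₁ ≤ n₁ - d + 1 ∧ 2 * ρ + ℓ₂ ≤ 2 * n₁ then
          (if (fun s c => (i = 1 → 2 * d ≤ s + 2 * c) ∧ (i ≠ 1 → d ≤ c)) s ((ℓ₁ + 2 * ρ - n₁ + 1) / 2) then εG 1 i else 0) *
            (q : ℚ) ^ (2 * ρ + s / 2 - (ℓ₁ + 2 * ρ - n₁ + 1) / 2) else 0) := by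
    intro ρ s hρ hs
    simp only []
    rw [hG2 ρ s hρ hs, (vec_single_ite _ _ i).2.1, (vec_bracket_ite _ _ (εG 1) i).2.1]
    congr 1
    by_cases hc : 2 ∣ s ∧ n₁ = n₃ ∧ n₂ = n₁ + s ∧ n₁ < 2 * ρ + ℓ₁ ∧ ℓ₁ + ρ ≤ n₁ ∧ ℓ₁ + 2 * ρ - n₁ ≤ n₁ - d + 1 ∧ 2 * ρ + ℓ₂ ≤ 2 * n₁
    · rw [if_pos hc, if_pos hc]
      congr 1
      exact if_congr (and_congr (imp_congr Iff.rfl (bracket_own_iff hc.1)) (imp_congr Iff.rfl (bracket_cross_iff d _))) rfl rfl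
    · rw [if_neg hc, if_neg hc]
  have hG3' : ∀ ρ s, 1 ≤ ρ → 1 ≤ s → (fun r t => v ![t, t, r]) (2 * ρ) (2 * ρ + s) =
      (if (i = 2) ∧ 2 ∣ s ∧ 2 * ρ ≤ min n₁ n₂ ∧ 2 * ρ + s ≤ n₃ ∧ 2 * ρ + ℓ₁ ≤ n₂ ∧ 2 * ρ + s + ℓ₁ ≤ n₃ ∧ 2 * ρ + ℓ₂ ≤ 2 * n₂ then
          ω * (q : ℚ) ^ (2 * ρ + s / 2 - 1) * ((if 2 * d ≤ s then (q : ℚ) - 1 else 0) - (if s + 2 = 2 * d then 1 else 0)) else 0) +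
      (if 2 ∣ s ∧ n₁ = n₂ ∧ n₃ = n₁ + s ∧ n₁ < 2 * ρ + ℓ₁ ∧ ℓ₁ + ρ ≤ n₁ ∧ ℓ₁ + 2 * ρ - n₁ ≤ n₁ - d + 1 ∧ 2 * ρ + ℓ₂ ≤ 2 * n₁ then
          (if (fun s c => (i = 2 → 2 * d ≤ s + 2 * c) ∧ (i ≠ 2 → d ≤ c)) s ((ℓ₁ + 2 * ρ - n₁ + 1) / 2) then εG 2 i else 0) *
            (q : ℚ) ^ (2 * ρ + s / 2 - (ℓ₁ + 2 * ρ - n₁ + 1) / 2) else 0) := by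
    intro ρ s hρ hs
    simp only []
    rw [hG3 ρ s hρ hs, (vec_single_ite _ _ i).2.2, (vec_bracket_ite _ _ (εG 2) i).2.2]
    congr 1
    by_cases hc : 2 ∣ s ∧ n₁ = n₂ ∧ n₃ = n₁ + s ∧ n₁ < 2 * ρ + ℓ₁ ∧ ℓ₁ + ρ ≤ n₁ ∧ ℓ₁ + 2 * ρ - n₁ ≤ n₁ - d + 1 ∧ 2 * ρ + ℓ₂ ≤ 2 * n₁
    · rw [if_pos hc, if_pos hc]
      congr 1
      exact if_congr (and_congr (imp_congr Iff.rfl (bracket_own_iff hc.1)) (imp_congr Iff.rfl (bracket_cross_iff d _))) rfl rfl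
    · rw [if_neg hc, if_neg hc]
  -- (2) diagonal + planes, evaluated
  rw [sum_box_eq_triple_sum, triple_sum_eq_diag_add_planes Bx v hreg,
    kappa_diag_sum_lev (q : ℚ) εH (n₁ = n₂) (n₂ = n₃) (d := d) (m := n₁) (ℓ₁ := ℓ₁) (ℓ₂ := ℓ₂) hdn1 (fun h12 h23 => by omega) (fun r => v ![r, r, r]) hcore hH hz_diag,
    kappa_plane_sum_lev (q : ℚ) ω (εG 0 i) (i = 0) (fun s c => (i = 0 → 2 * d ≤ s + 2 * c) ∧ (i ≠ 0 → d ≤ c)) (nr := n₂) hd hdn2 (by omega) hdn2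
      (by omega) (by omega) (fun r t => v ![r, t, t]) hT1 hG1' hz_p1,
    kappa_plane_sum_lev (q : ℚ) ω (εG 1 i) (i = 1) (fun s c => (i = 1 → 2 * d ≤ s + 2 * c) ∧ (i ≠ 1 → d ≤ c)) (nr := n₁) hd hdn1 (by omega) hdn1
      (by omega) (by omega) (fun r t => v ![t, r, t]) hT2 hG2' hz_p2,
    kappa_plane_sum_lev (q : ℚ) ω (εG 2 i) (i = 2) (fun s c => (i = 2 → 2 * d ≤ s + 2 * c) ∧ (i ≠ 2 → d ≤ c)) (nr := n₂) hd hdn1 (by omega) hdn2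
      (by omega) (by omega) (fun r t => v ![t, t, r]) hT3 hG3' hz_p3]
  -- (3) evaluate every block times `q − 1`
  have hbrk : ∀ (p : Fin 3) (s c : ℕ), ((i = p → 2 * d ≤ s + 2 * c) ∧ (i ≠ p → d ≤ c)) ↔ (if i = p then d - s / 2 else d) ≤ c := by
    intro p s c
    by_cases hip : i = p
    · rw [if_pos hip]; constructor
      · rintro ⟨h, -⟩; have := h hip; omega
      · intro h; exact ⟨fun _ => by omega, fun h' => absurd hip h'⟩
    · rw [if_neg hip]; constructor
      · rintro ⟨-, h⟩; exact h hip
      · intro h; exact ⟨fun h' => absurd h' hip, fun _ => h⟩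
  have eF0 : ((q : ℚ) - 1) * (ω * ∑ j ∈ Icc d ((n₁ - ℓ₁) / 2), (q : ℚ) ^ j) + ((q : ℚ) - 1) * (ω * ∑ ρ ∈ Icc 1 (min (min n₂ n₃) (min (n₂ - ℓ₁) (2 * n₂ - ℓ₂)) / 2),
      ((if ρ + d ≤ (n₁ - ℓ₁) / 2 then (q : ℚ) ^ ((n₁ - ℓ₁) / 2 + ρ) - (q : ℚ) ^ (2 * ρ + d - 1) else 0) - (if ρ + d ≤ (n₁ - ℓ₁) / 2 + 1 then (q : ℚ) ^ (2 * ρ + d - 2) else 0)))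
      = if min (min n₂ n₃) (min (n₂ - ℓ₁) (2 * n₂ - ℓ₂)) / 2 + d ≤ (n₁ - ℓ₁) / 2 then
          ω * ((q : ℚ) ^ ((n₁ - ℓ₁) / 2 + min (min n₂ n₃) (min (n₂ - ℓ₁) (2 * n₂ - ℓ₂)) / 2 + 1) - (q : ℚ) ^ (2 * (min (min n₂ n₃) (min (n₂ - ℓ₁) (2 * n₂ - ℓ₂)) / 2) + d)) else 0 := by
    rw [← mul_add, ← mul_add]; exact foot_mul_eval (q : ℚ) ω hd1 _ _
  have eF1 : ((q : ℚ) - 1) * (ω * ∑ j ∈ Icc d ((n₂ - ℓ₁) / 2), (q : ℚ) ^ j) + ((q : ℚ) - 1) * (ω * ∑ ρ ∈ Icc 1 (min (min n₁ n₃) (min (n₁ - ℓ₁) (2 * n₁ - ℓ₂)) / 2),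
      ((if ρ + d ≤ (n₂ - ℓ₁) / 2 then (q : ℚ) ^ ((n₂ - ℓ₁) / 2 + ρ) - (q : ℚ) ^ (2 * ρ + d - 1) else 0) - (if ρ + d ≤ (n₂ - ℓ₁) / 2 + 1 then (q : ℚ) ^ (2 * ρ + d - 2) else 0)))
      = if min (min n₁ n₃) (min (n₁ - ℓ₁) (2 * n₁ - ℓ₂)) / 2 + d ≤ (n₂ - ℓ₁) / 2 then
          ω * ((q : ℚ) ^ ((n₂ - ℓ₁) / 2 + min (min n₁ n₃) (min (n₁ - ℓ₁) (2 * n₁ - ℓ₂)) / 2 + 1) - (q : ℚ) ^ (2 * (min (min n₁ n₃) (min (n₁ - ℓ₁) (2 * n₁ - ℓ₂)) / 2) + d)) else 0 := by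
    rw [← mul_add, ← mul_add]; exact foot_mul_eval (q : ℚ) ω hd1 _ _
  have eF2 : ((q : ℚ) - 1) * (ω * ∑ j ∈ Icc d ((n₃ - ℓ₁) / 2), (q : ℚ) ^ j) + ((q : ℚ) - 1) * (ω * ∑ ρ ∈ Icc 1 (min (min n₁ n₂) (min (n₂ - ℓ₁) (2 * n₂ - ℓ₂)) / 2),
      ((if ρ + d ≤ (n₃ - ℓ₁) / 2 then (q : ℚ) ^ ((n₃ - ℓ₁) / 2 + ρ) - (q : ℚ) ^ (2 * ρ + d - 1) else 0) - (if ρ + d ≤ (n₃ - ℓ₁) / 2 + 1 then (q : ℚ) ^ (2 * ρ + d - 2) else 0)))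
      = if min (min n₁ n₂) (min (n₂ - ℓ₁) (2 * n₂ - ℓ₂)) / 2 + d ≤ (n₃ - ℓ₁) / 2 then
          ω * ((q : ℚ) ^ ((n₃ - ℓ₁) / 2 + min (min n₁ n₂) (min (n₂ - ℓ₁) (2 * n₂ - ℓ₂)) / 2 + 1) - (q : ℚ) ^ (2 * (min (min n₁ n₂) (min (n₂ - ℓ₁) (2 * n₂ - ℓ₂)) / 2) + d)) else 0 := by
    rw [← mul_add, ← mul_add]; exact foot_mul_eval (q : ℚ) ω hd1 _ _
  have eD : ((q : ℚ) - 1) * (εH * ∑ c ∈ Icc 1 (min (n₁ - ℓ₁ - (n₁ - ℓ₁) / 2) (min ((2 * n₁ - ℓ₂) / 2 - (n₁ - ℓ₁) / 2) ((2 * n₁ - d + 1 - ℓ₁) / 2 - (n₁ - ℓ₁) / 2))), (if d ≤ c then (q : ℚ) ^ (2 * ((n₁ - ℓ₁) / 2) + c) else 0))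
      = εH * (if max 1 d ≤ min (n₁ - ℓ₁ - (n₁ - ℓ₁) / 2) (min ((2 * n₁ - ℓ₂) / 2 - (n₁ - ℓ₁) / 2) ((2 * n₁ - d + 1 - ℓ₁) / 2 - (n₁ - ℓ₁) / 2)) then (q : ℚ) ^ (2 * ((n₁ - ℓ₁) / 2) + min (n₁ - ℓ₁ - (n₁ - ℓ₁) / 2) (min ((2 * n₁ - ℓ₂) / 2 - (n₁ - ℓ₁) / 2) ((2 * n₁ - d + 1 - ℓ₁) / 2 - (n₁ - ℓ₁) / 2)) + 1) - (q : ℚ) ^ (2 * ((n₁ - ℓ₁) / 2) + max 1 d) else 0) := by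
    rw [mul_left_comm, window_mul_eval]
  have eW0 : ((q : ℚ) - 1) * (εG 0 i * ∑ c ∈ Icc 1 (min (n₂ - ℓ₁ - (n₂ - ℓ₁) / 2) (min ((2 * n₂ - ℓ₂) / 2 - (n₂ - ℓ₁) / 2) ((2 * n₂ - d + 1 - ℓ₁) / 2 - (n₂ - ℓ₁) / 2))),
        (if (i = 0 → 2 * d ≤ n₁ - n₂ + 2 * c) ∧ (i ≠ 0 → d ≤ c) then (q : ℚ) ^ (2 * ((n₂ - ℓ₁) / 2) + (n₁ - n₂) / 2 + c) else 0))
      = εG 0 i * (if max 1 (if i = 0 then d - (n₁ - n₂) / 2 else d) ≤ min (n₂ - ℓ₁ - (n₂ - ℓ₁) / 2) (min ((2 * n₂ - ℓ₂) / 2 - (n₂ - ℓ₁) / 2) ((2 * n₂ - d + 1 - ℓ₁) / 2 - (n₂ - ℓ₁) / 2)) then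
          (q : ℚ) ^ (2 * ((n₂ - ℓ₁) / 2) + (n₁ - n₂) / 2 + min (n₂ - ℓ₁ - (n₂ - ℓ₁) / 2) (min ((2 * n₂ - ℓ₂) / 2 - (n₂ - ℓ₁) / 2) ((2 * n₂ - d + 1 - ℓ₁) / 2 - (n₂ - ℓ₁) / 2)) + 1) - (q : ℚ) ^ (2 * ((n₂ - ℓ₁) / 2) + (n₁ - n₂) / 2 + max 1 (if i = 0 then d - (n₁ - n₂) / 2 else d)) else 0) := by
    rw [mul_left_comm, window_mul_eval' (q : ℚ) _ _ _ _ (hbrk 0 (n₁ - n₂))]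
  have eW1 : ((q : ℚ) - 1) * (εG 1 i * ∑ c ∈ Icc 1 (min (n₁ - ℓ₁ - (n₁ - ℓ₁) / 2) (min ((2 * n₁ - ℓ₂) / 2 - (n₁ - ℓ₁) / 2) ((2 * n₁ - d + 1 - ℓ₁) / 2 - (n₁ - ℓ₁) / 2))),
        (if (i = 1 → 2 * d ≤ n₂ - n₁ + 2 * c) ∧ (i ≠ 1 → d ≤ c) then (q : ℚ) ^ (2 * ((n₁ - ℓ₁) / 2) + (n₂ - n₁) / 2 + c) else 0))
      = εG 1 i * (if max 1 (if i = 1 then d - (n₂ - n₁) / 2 else d) ≤ min (n₁ - ℓ₁ - (n₁ - ℓ₁) / 2) (min ((2 * n₁ - ℓ₂) / 2 - (n₁ - ℓ₁) / 2) ((2 * n₁ - d + 1 - ℓ₁) / 2 - (n₁ - ℓ₁) / 2)) then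
          (q : ℚ) ^ (2 * ((n₁ - ℓ₁) / 2) + (n₂ - n₁) / 2 + min (n₁ - ℓ₁ - (n₁ - ℓ₁) / 2) (min ((2 * n₁ - ℓ₂) / 2 - (n₁ - ℓ₁) / 2) ((2 * n₁ - d + 1 - ℓ₁) / 2 - (n₁ - ℓ₁) / 2)) + 1) - (q : ℚ) ^ (2 * ((n₁ - ℓ₁) / 2) + (n₂ - n₁) / 2 + max 1 (if i = 1 then d - (n₂ - n₁) / 2 else d)) else 0) := by
    rw [mul_left_comm, window_mul_eval' (q : ℚ) _ _ _ _ (hbrk 1 (n₂ - n₁))]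
  have eW2 : ((q : ℚ) - 1) * (εG 2 i * ∑ c ∈ Icc 1 (min (n₁ - ℓ₁ - (n₁ - ℓ₁) / 2) (min ((2 * n₁ - ℓ₂) / 2 - (n₁ - ℓ₁) / 2) ((2 * n₁ - d + 1 - ℓ₁) / 2 - (n₁ - ℓ₁) / 2))),
        (if (i = 2 → 2 * d ≤ n₃ - n₁ + 2 * c) ∧ (i ≠ 2 → d ≤ c) then (q : ℚ) ^ (2 * ((n₁ - ℓ₁) / 2) + (n₃ - n₁) / 2 + c) else 0))
      = εG 2 i * (if max 1 (if i = 2 then d - (n₃ - n₁) / 2 else d) ≤ min (n₁ - ℓ₁ - (n₁ - ℓ₁) / 2) (min ((2 * n₁ - ℓ₂) / 2 - (n₁ - ℓ₁) / 2) ((2 * n₁ - d + 1 - ℓ₁) / 2 - (n₁ - ℓ₁) / 2)) then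
          (q : ℚ) ^ (2 * ((n₁ - ℓ₁) / 2) + (n₃ - n₁) / 2 + min (n₁ - ℓ₁ - (n₁ - ℓ₁) / 2) (min ((2 * n₁ - ℓ₂) / 2 - (n₁ - ℓ₁) / 2) ((2 * n₁ - d + 1 - ℓ₁) / 2 - (n₁ - ℓ₁) / 2)) + 1) - (q : ℚ) ^ (2 * ((n₁ - ℓ₁) / 2) + (n₃ - n₁) / 2 + max 1 (if i = 2 then d - (n₃ - n₁) / 2 else d)) else 0) := by
    rw [mul_left_comm, window_mul_eval' (q : ℚ) _ _ _ _ (hbrk 2 (n₃ - n₁))]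
  simp only [mul_add, mul_ite, mul_zero]
  rw [eF0, eF1, eF2, eD, eW0, eW1, eW2]
  clear eF0 eF1 eF2 eD eW0 eW1 eW2 hG1' hG2' hG3' hG1 hG2 hG3 hT1 hT2 hT3 hH hzero hreg hz_diag hz_p1 hz_p2 hz_p3 hcore hbrk
  exact kappa_arith_lev (q : ℚ) ω εH εG hd hiso h1 h2 h3 hk hf1 hf2 hf3 hℓ₁ hℓ₂ hcorner i hω0 hω1 hω2

/-- **`LevLabelledBoxSum ℓ₁ ℓ₂` HOLDS** (the interior Prop ★ p860066, fence `ℓ₂ ≤ nᵢ`), by ★ `levLabelledBoxSum_of_wide`. [folklore] -/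
theorem levLabelledBoxSum_holds (ℓ₁ ℓ₂ : ℕ) : LevLabelledBoxSum ℓ₁ ℓ₂ :=
  levLabelledBoxSum_of_wide ℓ₁ ℓ₂ (levLabelledBoxSumWide_holds ℓ₁ ℓ₂)

end Summit.HodgeConjecture.HodgeConjecture.Cruxes.H413.F0P3cDyRamLevLabelledBoxSum
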